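import Mathlib
import HarnessLib
import Literature.Combinatorics.SimpleGraph.FKPseudomoments
import Summits.PneNP.PneNP.Theorems.RamseyUncertifiablePaleySosRungShellPatternTools

/-!
# The filled-matrix shell, Step B, part 2: the pattern part is dominated (crux `PaleySosRung`,
line `weil-patch-transfer`, registered sub-goal `shell_patternPart` of stub `stub_filledShell`)

`|Σ_{L,R} x_L x_R lev|L∪R| (bipInd(L,R) − 2^{-|L∖R||R∖L|})| ≤ ε t² Σ_L lev|L| x_L²` for `x`
supported on `{1 ≤ |L| ≤ t}`, given abstract bilinear bounds `N(a,b)` for the rectangular MPW cross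
matrices on `a`-sets × `b`-sets (`1 ≤ a,b ≤ t`) and the parameter condition
`(lev(a+b+s)/2^{ab} · N(a,b))² C(a+s,s) C(b+s,s) ≤ ε² lev(a+s) lev(b+s)`.
Proof: parametrise `(L,R)` by `(T, A, B) = (L ∩ R, L ∖ R, R ∖ L)` (part 1), group by sizes, bound
each bilinear piece by the hypothesis, sum over `T` of a fixed size with Cauchy–Schwarz
(`Σ_{|T|=s} ‖u_T^{(a)}‖² = C(a+s,s) X_{a+s}`, part 1), then two more Cauchy–Schwarz/counting steps.
-/

set_option linter.dupNamespace false -- `Summit.PneNP.PneNP.…`: summit = sub-problem (D-0017)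

namespace Summit.PneNP.PneNP.Theorems.PaleySosRungWeilPatch

open Finset

/-- **Step B of the shell (lead's copy): the pattern part is dominated.** Registered sub-goal
`shell_patternPart` of stub `stub_filledShell` (crux stmt-PneNP-9817). -/
theorem shell_patternPart :
    ∀ (m t : ℕ) (G : SimpleGraph (Fin m)) [DecidableRel G.Adj] (N : ℕ → ℕ → ℝ) (lev : ℕ → ℝ) (ε : ℝ), 0 ≤ ε → (∀ n, 0 < lev n) → (∀ a b, 0 ≤ N a b) → (∀ a b : ℕ, 1 ≤ a → a ≤ t → 1 ≤ b → b ≤ t → ∀ (u : {S : Finset (Fin m) // S.card = a} → ℝ) (v : {S : Finset (Fin m) // S.card = b} → ℝ), |∑ A, ∑ B, u A * v B * (if Disjoint A.1 B.1 then (if ∀ x ∈ A.1, ∀ y ∈ B.1, G.Adj x y then (2 : ℝ) ^ (a * b) - 1 else -1) else 0)| ≤ N a b * Real.sqrt (∑ A, u A ^ 2) * Real.sqrt (∑ B, v B ^ 2)) → (∀ a b s : ℕ, 1 ≤ a → 1 ≤ b → a + s ≤ t → b + s ≤ t → (lev (a + b + s) / 2 ^ (a * b) * N a b) ^ 2 *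 (((a + s).choose s : ℝ) * ((b + s).choose s : ℝ)) ≤ ε ^ 2 * (lev (a + s) * lev (b + s))) → ∀ (x : Finset (Fin m) → ℝ), x ∅ = 0 → (∀ L : Finset (Fin m), t < L.card → x L = 0) → |∑ L : Finset (Fin m), ∑ R : Finset (Fin m), x L * x R * (lev (L ∪ R).card * (Literature.Combinatorics.SimpleGraph.bipInd G L R - 1 / 2 ^ ((L \ R).card * (R \ L).card)))| ≤ ε * t ^ 2 * ∑ L : Finset (Fin m), lev L.card * x L ^ 2 := by
  intro m t G _ N lev ε hε hlev hN hcross hpar x hx0 hxt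
  classical
  -- objects
  set u : Finset (Fin m) → Finset (Fin m) → ℝ := fun T A => if Disjoint A T then x (A ∪ T) else 0
    with hu
  set cr : ℕ → ℕ → Finset (Fin m) → Finset (Fin m) → ℝ := fun a b A B =>
    if Disjoint A B then (if ∀ x ∈ A, ∀ y ∈ B, G.Adj x y then (2 : ℝ) ^ (a * b) - 1 else -1) else 0
    with hcr
  set Bil : Finset (Fin m) → ℕ → ℕ → ℝ := fun T a b => ∑ A : Finset (Fin m), ∑ B : Finset (Fin m),
    (if A.card = a then u T A else 0) * (if B.card = b then u T B else 0) * cr a b A B with hBil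
  set nsq : Finset (Fin m) → ℕ → ℝ := fun T a => ∑ A : Finset (Fin m),
    (if A.card = a then u T A else 0) ^ 2 with hnsq
  set X : ℕ → ℝ := fun i => ∑ L : Finset (Fin m), (if L.card = i then x L ^ 2 else 0) with hX
  set coef : ℕ → ℕ → ℕ → ℝ := fun a b s => lev (a + b + s) / 2 ^ (a * b) with hcoef
  have hcoef0 : ∀ a b s, 0 ≤ coef a b s := fun a b s => div_nonneg (hlev _).le (by positivity)
  have hX0 : ∀ i, 0 ≤ X i := fun i => Finset.sum_nonneg fun L _ => by
    by_cases h : L.card = i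
    · rw [if_pos h]; positivity
    · rw [if_neg h]
  -- `u T A = 0` unless `|A| + |T| ≤ t`
  have hu0 : ∀ T A : Finset (Fin m), t < A.card + T.card → u T A = 0 := by
    intro T A h
    simp only [hu]
    split_ifs with hd
    · exact hxt _ (by rw [Finset.card_union_of_disjoint hd]; exact h)
    · rfl
  -- (1) the pattern part through `(T, A, B)`
  have hsummand : ∀ T A B : Finset (Fin m),
      (if Disjoint A T ∧ Disjoint B T ∧ Disjoint A B then
        x (A ∪ T) * x (B ∪ T) * (lev ((A ∪ T) ∪ (B ∪ T)).card *
          (Literature.Combinatorics.SimpleGraph.bipInd G (A ∪ T) (B ∪ T) -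
            1 / 2 ^ (((A ∪ T) \ (B ∪ T)).card * ((B ∪ T) \ (A ∪ T)).card))) else 0) =
        u T A * u T B * (coef A.card B.card T.card * cr A.card B.card A B) :=
    fun T A B => pattern_summand_eq G lev x T A B
  have hP : ∑ L : Finset (Fin m), ∑ R : Finset (Fin m), x L * x R *
      (lev (L ∪ R).card * (Literature.Combinatorics.SimpleGraph.bipInd G L R -
        1 / 2 ^ ((L \ R).card * (R \ L).card))) =
      ∑ T : Finset (Fin m), ∑ a ∈ Finset.range (t + 1), ∑ b ∈ Finset.range (t + 1),
        coef a b T.card * Bil T a b := by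
    rw [sum_pairs_by_inter]
    refine Finset.sum_congr rfl fun T _ => ?_
    rw [Finset.sum_congr rfl fun A _ => Finset.sum_congr rfl fun B _ => hsummand T A B]
    -- group `A` by size
    rw [sum_group_card t (fun A => ∑ B : Finset (Fin m),
      u T A * u T B * (coef A.card B.card T.card * cr A.card B.card A B)) (fun A hA => by
        refine Finset.sum_eq_zero fun B _ => ?_
        rw [hu0 T A (by omega), zero_mul, zero_mul])]
    refine Finset.sum_congr rfl fun a _ => ?_
    -- inside: Σ_A [|A|=a] Σ_B … ; group `B` by size
    calc ∑ A : Finset (Fin m), (if A.card = a then ∑ B : Finset (Fin m),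
          u T A * u T B * (coef A.card B.card T.card * cr A.card B.card A B) else 0)
        = ∑ A : Finset (Fin m), ∑ B : Finset (Fin m), (if A.card = a then
            u T A * u T B * (coef a B.card T.card * cr a B.card A B) else 0) := by
          refine Finset.sum_congr rfl fun A _ => ?_
          split_ifs with hA
          · rw [hA]
          · exact (Finset.sum_eq_zero fun B _ => rfl).symm
      _ = ∑ B : Finset (Fin m), ∑ A : Finset (Fin m), (if A.card = a then
            u T A * u T B * (coef a B.card T.card * cr a B.card A B) else 0) := Finset.sum_comm
      _ = ∑ b ∈ Finset.range (t + 1), ∑ B : Finset (Fin m), (if B.card = b then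
            ∑ A : Finset (Fin m), (if A.card = a then
              u T A * u T B * (coef a B.card T.card * cr a B.card A B) else 0) else 0) := by
          refine sum_group_card t _ fun B hB => ?_
          refine Finset.sum_eq_zero fun A _ => ?_
          split_ifs
          · rw [hu0 T B (by omega), mul_zero, zero_mul]
          · rfl
      _ = ∑ b ∈ Finset.range (t + 1), coef a b T.card * Bil T a b := by
          refine Finset.sum_congr rfl fun b _ => ?_
          simp only [hBil, Finset.mul_sum]
          rw [Finset.sum_comm]
          refine Finset.sum_congr rfl fun B _ => ?_
          by_cases hB : B.card = b
          · rw [if_pos hB]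
            refine Finset.sum_congr rfl fun A _ => ?_
            rw [hB]
            by_cases hA : A.card = a
            · rw [if_pos hA, if_pos hA, if_pos rfl]; ring
            · rw [if_neg hA, if_neg hA]; ring
          · rw [if_neg hB]
            refine (Finset.sum_eq_zero fun A _ => ?_).symm
            rw [if_neg hB]; ring
  -- (2) the bilinear bound from the hypothesis
  have hBilbd : ∀ (T : Finset (Fin m)) (a b : ℕ), 1 ≤ a → a ≤ t → 1 ≤ b → b ≤ t →
      |Bil T a b| ≤ N a b * Real.sqrt (nsq T a) * Real.sqrt (nsq T b) := by
    intro T a b ha hat hb hbt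
    have h := hcross a b ha hat hb hbt (fun A => u T A.1) (fun B => u T B.1)
    have e1 : ∑ A : {S : Finset (Fin m) // S.card = a}, ∑ B : {S : Finset (Fin m) // S.card = b},
        u T A.1 * u T B.1 * (if Disjoint A.1 B.1 then
          (if ∀ x ∈ A.1, ∀ y ∈ B.1, G.Adj x y then (2 : ℝ) ^ (a * b) - 1 else -1) else 0) =
        Bil T a b := by
      simp only [hBil]
      rw [sum_cardSubtype_eq (fun A => ∑ B : {S : Finset (Fin m) // S.card = b},
        u T A * u T B.1 * (if Disjoint A B.1 then
          (if ∀ x ∈ A, ∀ y ∈ B.1, G.Adj x y then (2 : ℝ) ^ (a * b) - 1 else -1) else 0))]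
      refine Finset.sum_congr rfl fun A _ => ?_
      split_ifs with hA
      · rw [sum_cardSubtype_eq (fun B => u T A * u T B * (if Disjoint A B then
          (if ∀ x ∈ A, ∀ y ∈ B, G.Adj x y then (2 : ℝ) ^ (a * b) - 1 else -1) else 0))]
        refine Finset.sum_congr rfl fun B _ => ?_
        simp only [hcr]
        split_ifs <;> ring
      · refine (Finset.sum_eq_zero fun B _ => ?_).symm
        rw [zero_mul, zero_mul]
    have e2 : ∑ A : {S : Finset (Fin m) // S.card = a}, u T A.1 ^ 2 = nsq T a := by
      simp only [hnsq]
      rw [sum_cardSubtype_eq (fun A => u T A ^ 2)]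
      refine Finset.sum_congr rfl fun A _ => ?_
      split_ifs <;> simp
    have e3 : ∑ B : {S : Finset (Fin m) // S.card = b}, u T B.1 ^ 2 = nsq T b := by
      simp only [hnsq]
      rw [sum_cardSubtype_eq (fun B => u T B ^ 2)]
      refine Finset.sum_congr rfl fun B _ => ?_
      split_ifs <;> simp
    rw [e1, e2, e3] at h
    exact h
  -- (3) vanishing of `Bil` for inadmissible sizes
  have hBil0a : ∀ (T : Finset (Fin m)) (b : ℕ), Bil T 0 b = 0 := by
    intro T b
    simp only [hBil]
    refine Finset.sum_eq_zero fun A _ => Finset.sum_eq_zero fun B _ => ?_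
    by_cases hA : A.card = 0
    · have hA' : A = ∅ := Finset.card_eq_zero.1 hA
      simp only [hcr, hA', Finset.disjoint_empty_left, if_true, Finset.notMem_empty,
        IsEmpty.forall_iff, implies_true, zero_mul, pow_zero, sub_self, mul_zero]
    · rw [if_neg hA, zero_mul, zero_mul]
  have hBil0b : ∀ (T : Finset (Fin m)) (a : ℕ), Bil T a 0 = 0 := by
    intro T a
    simp only [hBil]
    refine Finset.sum_eq_zero fun A _ => Finset.sum_eq_zero fun B _ => ?_
    by_cases hB : B.card = 0
    · have hB' : B = ∅ := Finset.card_eq_zero.1 hB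
      simp only [hcr, hB', Finset.disjoint_empty_right, if_true, Finset.notMem_empty,
        IsEmpty.forall_iff, implies_true, mul_zero, pow_zero, sub_self]
    · rw [if_neg hB, mul_zero, zero_mul]
  have hnsq0 : ∀ (T : Finset (Fin m)) (a : ℕ), t < a + T.card → nsq T a = 0 := by
    intro T a h
    simp only [hnsq]
    refine Finset.sum_eq_zero fun A _ => ?_
    split_ifs with hA
    · rw [hu0 T A (by omega)]; simp
    · simp
  have hnsq_nonneg : ∀ T a, 0 ≤ nsq T a := fun T a => Finset.sum_nonneg fun A _ => sq_nonneg _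
  have hBil0c : ∀ (T : Finset (Fin m)) (a b : ℕ), 1 ≤ a → a ≤ t → 1 ≤ b → b ≤ t →
      (t < a + T.card ∨ t < b + T.card) → Bil T a b = 0 := by
    intro T a b ha hat hb hbt h
    have hb' := hBilbd T a b ha hat hb hbt
    rcases h with h | h
    · rw [hnsq0 T a h, Real.sqrt_zero, mul_zero, zero_mul] at hb'
      exact abs_nonpos_iff.1 hb'
    · rw [hnsq0 T b h, Real.sqrt_zero, mul_zero] at hb'
      exact abs_nonpos_iff.1 hb'
  -- (4) the counting identity `Σ_{|T|=s} nsq T a = C(a+s,s) X(a+s)`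
  have hcount : ∀ a s : ℕ, ∑ T : Finset (Fin m), (if T.card = s then nsq T a else 0) =
      ((a + s).choose s : ℝ) * X (a + s) := fun a s => pattern_count_identity x a s
  -- (5) per-(a,b,s) estimate
  set w : ℕ → ℝ := fun i => Real.sqrt (lev i * X i) with hw
  have hterm : ∀ a ∈ Finset.range (t + 1), ∀ b ∈ Finset.range (t + 1), ∀ s ∈ Finset.range (t + 1),
      coef a b s * ∑ T : Finset (Fin m), (if T.card = s then |Bil T a b| else 0) ≤
        if (1 ≤ a ∧ a + s ≤ t) ∧ (1 ≤ b ∧ b + s ≤ t) then ε * (w (a + s) * w (b + s)) else 0 := by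
    intro a ha b hb s hs
    rw [Finset.mem_range] at ha hb hs
    by_cases hadm : (1 ≤ a ∧ a + s ≤ t) ∧ (1 ≤ b ∧ b + s ≤ t)
    · rw [if_pos hadm]
      obtain ⟨⟨ha1, has⟩, ⟨hb1, hbs⟩⟩ := hadm
      -- Cauchy–Schwarz over `T`
      have hcs : ∑ T : Finset (Fin m), (if T.card = s then |Bil T a b| else 0) ≤
          N a b * (Real.sqrt (((a + s).choose s : ℝ) * X (a + s)) *
            Real.sqrt (((b + s).choose s : ℝ) * X (b + s))) := by
        have hle : ∀ T : Finset (Fin m), (if T.card = s then |Bil T a b| else 0) ≤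
            N a b * ((if T.card = s then Real.sqrt (nsq T a) else 0) *
              (if T.card = s then Real.sqrt (nsq T b) else 0)) := by
          intro T
          split_ifs with hT
          · rw [← mul_assoc]; exact hBilbd T a b ha1 (by omega) hb1 (by omega)
          · simp
        refine (Finset.sum_le_sum fun T _ => hle T).trans ?_
        rw [← Finset.mul_sum]
        refine mul_le_mul_of_nonneg_left ?_ (hN a b)
        have hcs' := Finset.sum_mul_sq_le_sq_mul_sq (Finset.univ : Finset (Finset (Fin m)))
          (fun T => if T.card = s then Real.sqrt (nsq T a) else 0)
          (fun T => if T.card = s then Real.sqrt (nsq T b) else 0)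
        have hf2 : ∀ c : ℕ, ∑ T : Finset (Fin m), (if T.card = s then Real.sqrt (nsq T c) else 0) ^ 2 =
            ((c + s).choose s : ℝ) * X (c + s) := by
          intro c
          rw [← hcount c s]
          refine Finset.sum_congr rfl fun T _ => ?_
          split_ifs
          · exact Real.sq_sqrt (hnsq_nonneg T c)
          · simp
        rw [hf2 a, hf2 b] at hcs'
        have hpos : 0 ≤ ∑ T : Finset (Fin m), (if T.card = s then Real.sqrt (nsq T a) else 0) *
            (if T.card = s then Real.sqrt (nsq T b) else 0) :=
          Finset.sum_nonneg fun T _ => by split_ifs <;> positivity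
        rw [← Real.sqrt_mul (by positivity)]
        exact Real.le_sqrt_of_sq_le hcs'
      -- the parameter condition
      have hparam : coef a b s * N a b * (Real.sqrt (((a + s).choose s : ℝ) * X (a + s)) *
          Real.sqrt (((b + s).choose s : ℝ) * X (b + s))) ≤ ε * (w (a + s) * w (b + s)) := by
        have hp := hpar a b s ha1 hb1 has hbs
        have hcN : 0 ≤ coef a b s * N a b := mul_nonneg (hcoef0 a b s) (hN a b)
        -- square roots of the parameter condition
        have hsq : coef a b s * N a b * Real.sqrt (((a + s).choose s : ℝ) * ((b + s).choose s : ℝ)) ≤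
            ε * Real.sqrt (lev (a + s) * lev (b + s)) := by
          have h1 : Real.sqrt ((coef a b s * N a b) ^ 2 * (((a + s).choose s : ℝ) * ((b + s).choose s : ℝ))) ≤
              Real.sqrt (ε ^ 2 * (lev (a + s) * lev (b + s))) := Real.sqrt_le_sqrt hp
          rwa [Real.sqrt_mul (sq_nonneg (coef a b s * N a b)), Real.sqrt_mul (sq_nonneg ε),
            Real.sqrt_sq hcN, Real.sqrt_sq hε] at h1
        have hXX : 0 ≤ Real.sqrt (X (a + s)) * Real.sqrt (X (b + s)) := by positivity
        calc coef a b s * N a b * (Real.sqrt (((a + s).choose s : ℝ) * X (a + s)) *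
              Real.sqrt (((b + s).choose s : ℝ) * X (b + s)))
            = (coef a b s * N a b * Real.sqrt (((a + s).choose s : ℝ) * ((b + s).choose s : ℝ))) *
                (Real.sqrt (X (a + s)) * Real.sqrt (X (b + s))) := by
              rw [Real.sqrt_mul (by positivity), Real.sqrt_mul (by positivity),
                Real.sqrt_mul (by positivity)]
              ring
          _ ≤ (ε * Real.sqrt (lev (a + s) * lev (b + s))) *
                (Real.sqrt (X (a + s)) * Real.sqrt (X (b + s))) :=
              mul_le_mul_of_nonneg_right hsq hXX
          _ = ε * (w (a + s) * w (b + s)) := by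
              simp only [hw]
              rw [Real.sqrt_mul (hlev _).le, Real.sqrt_mul (hlev _).le, Real.sqrt_mul (hlev _).le]
              ring
      calc coef a b s * ∑ T : Finset (Fin m), (if T.card = s then |Bil T a b| else 0)
          ≤ coef a b s * (N a b * (Real.sqrt (((a + s).choose s : ℝ) * X (a + s)) *
              Real.sqrt (((b + s).choose s : ℝ) * X (b + s)))) :=
            mul_le_mul_of_nonneg_left hcs (hcoef0 a b s)
        _ = coef a b s * N a b * (Real.sqrt (((a + s).choose s : ℝ) * X (a + s)) *
              Real.sqrt (((b + s).choose s : ℝ) * X (b + s))) := by ring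
        _ ≤ ε * (w (a + s) * w (b + s)) := hparam
    · rw [if_neg hadm]
      -- every `Bil T a b` vanishes
      have h0 : ∀ T : Finset (Fin m), T.card = s → Bil T a b = 0 := by
        intro T hT
        by_cases ha0 : a = 0
        · rw [ha0]; exact hBil0a T b
        by_cases hb0 : b = 0
        · rw [hb0]; exact hBil0b T a
        refine hBil0c T a b (by omega) (by omega) (by omega) (by omega) ?_
        rw [hT]; omega
      rw [Finset.sum_eq_zero fun T _ => ?_, mul_zero]
      split_ifs with hT
      · rw [h0 T hT, abs_zero]
      · rfl
  -- (6) assemble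
  have habs : |∑ T : Finset (Fin m), ∑ a ∈ Finset.range (t + 1), ∑ b ∈ Finset.range (t + 1),
      coef a b T.card * Bil T a b| ≤
      ∑ a ∈ Finset.range (t + 1), ∑ b ∈ Finset.range (t + 1), ∑ s ∈ Finset.range (t + 1),
        coef a b s * ∑ T : Finset (Fin m), (if T.card = s then |Bil T a b| else 0) := by
    calc |∑ T : Finset (Fin m), ∑ a ∈ Finset.range (t + 1), ∑ b ∈ Finset.range (t + 1),
          coef a b T.card * Bil T a b|
        ≤ ∑ T : Finset (Fin m), ∑ a ∈ Finset.range (t + 1), ∑ b ∈ Finset.range (t + 1),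
            coef a b T.card * |Bil T a b| := by
          refine (Finset.abs_sum_le_sum_abs _ _).trans (Finset.sum_le_sum fun T _ => ?_)
          refine (Finset.abs_sum_le_sum_abs _ _).trans (Finset.sum_le_sum fun a _ => ?_)
          refine (Finset.abs_sum_le_sum_abs _ _).trans (Finset.sum_le_sum fun b _ => ?_)
          rw [abs_mul, abs_of_nonneg (hcoef0 _ _ _)]
      _ = ∑ a ∈ Finset.range (t + 1), ∑ b ∈ Finset.range (t + 1), ∑ T : Finset (Fin m),
            coef a b T.card * |Bil T a b| := by
          rw [Finset.sum_comm]
          refine Finset.sum_congr rfl fun a _ => ?_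
          rw [Finset.sum_comm]
      _ = _ := by
          refine Finset.sum_congr rfl fun a _ => Finset.sum_congr rfl fun b _ => ?_
          rw [sum_group_card t (fun T => coef a b T.card * |Bil T a b|) (fun T hT => ?_)]
          · refine Finset.sum_congr rfl fun s _ => ?_
            rw [Finset.mul_sum]
            refine Finset.sum_congr rfl fun T _ => ?_
            split_ifs with hT
            · rw [hT]
            · rw [mul_zero]
          · -- `|T| > t`: `Bil T a b = 0`
            have : Bil T a b = 0 := by
              simp only [hBil]
              refine Finset.sum_eq_zero fun A _ => Finset.sum_eq_zero fun B _ => ?_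
              rw [hu0 T A (by omega)]
              simp
            rw [this, abs_zero, mul_zero]
  rw [hP]
  refine habs.trans ?_
  calc ∑ a ∈ Finset.range (t + 1), ∑ b ∈ Finset.range (t + 1), ∑ s ∈ Finset.range (t + 1),
        coef a b s * ∑ T : Finset (Fin m), (if T.card = s then |Bil T a b| else 0)
      ≤ ∑ a ∈ Finset.range (t + 1), ∑ b ∈ Finset.range (t + 1), ∑ s ∈ Finset.range (t + 1),
          (if (1 ≤ a ∧ a + s ≤ t) ∧ (1 ≤ b ∧ b + s ≤ t) then ε * (w (a + s) * w (b + s)) else 0) :=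
        Finset.sum_le_sum fun a ha => Finset.sum_le_sum fun b hb => Finset.sum_le_sum fun s hs =>
          hterm a ha b hb s hs
    _ = ε * ∑ s ∈ Finset.range (t + 1),
          (∑ a ∈ Finset.range (t + 1), (if 1 ≤ a ∧ a + s ≤ t then w (a + s) else 0)) ^ 2 := by
        rw [Finset.mul_sum]
        rw [Finset.sum_comm]
        refine (Finset.sum_congr rfl fun a _ => Finset.sum_comm).trans ?_
        rw [Finset.sum_comm]
        refine Finset.sum_congr rfl fun s _ => ?_
        rw [sq, Finset.sum_mul_sum, Finset.mul_sum]
        refine Finset.sum_congr rfl fun a _ => ?_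
        rw [Finset.mul_sum]
        refine Finset.sum_congr rfl fun b _ => ?_
        by_cases h1 : 1 ≤ a ∧ a + s ≤ t
        · by_cases h2 : 1 ≤ b ∧ b + s ≤ t
          · rw [if_pos (And.intro h2 h1), if_pos h1, if_pos h2]; ring
          · rw [if_neg (fun h => h2 h.1), if_pos h1, if_neg h2]; ring
        · rw [if_neg (fun h => h1 h.2), if_neg h1]; ring
    _ ≤ ε * ∑ s ∈ Finset.range (t + 1), ((t : ℝ) *
          ∑ a ∈ Finset.range (t + 1), (if 1 ≤ a ∧ a + s ≤ t then w (a + s) ^ 2 else 0)) := by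
        gcongr with s hs
        -- Cauchy–Schwarz over the ≤ t admissible values of `a`
        rw [← Finset.sum_filter, ← Finset.sum_filter]
        refine sq_sum_le_card_mul_sum_sq.trans ?_
        have hsub : (Finset.range (t + 1)).filter (fun a => 1 ≤ a ∧ a + s ≤ t) ⊆ Finset.Icc 1 t := by
          intro a ha
          rw [Finset.mem_filter] at ha
          rw [Finset.mem_Icc]; omega
        have hcard : (((Finset.range (t + 1)).filter (fun a => 1 ≤ a ∧ a + s ≤ t)).card : ℝ) ≤ t := by
          calc (((Finset.range (t + 1)).filter (fun a => 1 ≤ a ∧ a + s ≤ t)).card : ℝ)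
              ≤ ((Finset.Icc 1 t).card : ℝ) := by exact_mod_cast Finset.card_le_card hsub
            _ = t := by simp
        exact mul_le_mul_of_nonneg_right hcard (Finset.sum_nonneg fun a _ => sq_nonneg _)
    _ = ε * t * ∑ s ∈ Finset.range (t + 1), ∑ a ∈ Finset.range (t + 1),
          (if 1 ≤ a ∧ a + s ≤ t then lev (a + s) * X (a + s) else 0) := by
        rw [← Finset.mul_sum, mul_assoc]
        congr 1; congr 1
        refine Finset.sum_congr rfl fun s _ => Finset.sum_congr rfl fun a _ => ?_
        by_cases h : 1 ≤ a ∧ a + s ≤ t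
        · rw [if_pos h, if_pos h]
          simp only [hw]
          rw [Real.sq_sqrt (mul_nonneg (hlev _).le (hX0 _))]
        · rw [if_neg h, if_neg h]
    _ ≤ ε * t * ((t : ℝ) * ∑ i ∈ Finset.range (t + 1), lev i * X i) := by
        refine mul_le_mul_of_nonneg_left ?_ (by positivity)
        exact sum_shifted_le t (fun i => lev i * X i) fun i => mul_nonneg (hlev _).le (hX0 _)
    _ = ε * t ^ 2 * ∑ L : Finset (Fin m), lev L.card * x L ^ 2 := by
        rw [sum_group_card t (fun L => lev L.card * x L ^ 2) (fun L hL => by rw [hxt L hL]; ring)]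
        simp only [hX]
        have : ∀ i ∈ Finset.range (t + 1), lev i * ∑ L : Finset (Fin m), (if L.card = i then x L ^ 2 else 0) =
            ∑ L : Finset (Fin m), (if L.card = i then lev L.card * x L ^ 2 else 0) := by
          intro i _
          rw [Finset.mul_sum]
          refine Finset.sum_congr rfl fun L _ => ?_
          split_ifs with h
          · rw [h]
          · rw [mul_zero]
        rw [Finset.sum_congr rfl this]
        ring

end Summit.PneNP.PneNP.Theorems.PaleySosRungWeilPatch
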